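/-
Copyright (c) 2026 the pub-hodgecm-mathlib formalisation cell (harness21).  Prover seat hodgecm-mathlib-LH4-p06 (g2): Track A «(D-RAM) FOUR-FRAME» squad of crux H413
(dealer LH4-plan (g11) WORD #11: «(ρ2′) children as a RowTwoAtCoefStar-style reduction ★ + the split text»), 2026-09-04.
-/
import Summits.HodgeConjecture.HodgeConjecture.Theorems.F0P3cDyRamRowOneAtCoefStar      -- ★ p855881 (LH4-p06 (g2)): the coef* scalar identities, `natCast_card_residueField_sub_one_ne_zero`; brings ★ RowThreeReduction (`measureReal_support_hFamily_ne_zero`)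
import HarnessLib

/-!
# F0 · P3c · line LH4 «(D-RAM) FOUR-FRAME» — unit (ii-H), child (ρ2′): ROW (2) OF THE ROWS SOCKET (ρ) AT THE EXPLICIT COEFFICIENTS, REDUCED TO (ρ2a) ∧ (ρ2b)
(Rogawski 1990 §4.9 Prop. 4.9.1 (b), Lemma 4.9.3; §4.3 (4.3.1))

Cell `pub/hodgecm-mathlib`, crux H413 = `stmt-HodgeConjecture-24833` (helper lane); THEOREMS ONLY (no definition, no instance, no notation, no named fact, no `sorry`), typed under the
LINE FILE's scopes (`open scoped Matrix MatrixGroups Classical ValuativeRel WithZero`: `𝒪[K]` = `Valuation.integer (valuation K)`).  Tree socket served: (ρ2′) `stub_U2H_rowTwo_unit0` of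
`Cruxes/H413/Lines/F0_P3c_DyRamFourFrame_U2H_HSide.lean` (ED. 9 «composition edition», LH4-p06 (g2) cand e0509d4bd9082c65): ROW (2) of (ρ) with `coef s ↦ coef* s`.

THE MATHEMATICS (REF5 R5-61 (4), the type-(2) tree model).  On the TYPE-(2) population near `1 ∈ H_v` (`γ_H.1` with NO eigenvalue in `L_w`) the H-side profiles are
single-class counts `Φ^st(γ_H, h_s) = ν_s·N_s` with `N_E = N_V − 1` (★ p855511, LH4-p13 (g0) (e₀): vertex∕edge columns), i.e. in the coef* currency
(ρ2a) `∃ X, ∀ s, Φ^st(γ_H, h_s) = ν_s·X + lam*_s∕2` (`lam*_V = 0`, `lam*_E = −2ν_E`; `X = N_V`).  With `Σ_s coef*_s ν_s = C` and `Σ_s coef*_s lam*_s = −4C(q^S − 1)∕(q − 1)` (★ p855881 §1),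
`Σ_s coef*_s Φ^st(γ_H, h_s) = C·X − 2C(q^S − 1)∕(q − 1)` and `X = Φ^st(γ_H, h_{s_V})∕ν_{s_V}` (`s_V = d % 2`); so ROW (2) at coef* ⟸ (ρ2a) ∧ (ρ2b), where
(ρ2b) `Σᶠ_c Δ‴(γ_H, out c)·Φ(c, 1_{K_t}) = C·Φ^st(γ_H, h_{s_V})∕ν_{s_V} − 2C(q^S − 1)∕(q − 1)` is THE law₂ content (κ-gated G-side (e₁) against the vertex-profile H-side).

* §1 `rowTwo_algebra` (generic: `∃ X` affine H-side + the G-side identity ⇒ the row sum, given the two scalar identities).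
* §2 HEAD **`rowTwo_coefStar_of_hProfiles_affine_of_gSide`** — (ρ2′)'s conclusion VERBATIM from the conclusions of (ρ2a), (ρ2b) at the (ρ) telescope through `(C : ℂ)`.

HONEST LABEL: HC_CM is proved only modulo the 7 printed citations (2 remaining named inputs: hLiu418 = stmt-HodgeConjecture-24832, h413 = stmt-HodgeConjecture-24833) until rung 0
closes; this file is a reduction (count-neutral) — it does NOT assert (ρ2a) or (ρ2b), which stay sorried targets of the (e) side.

## References
* [Rogawski1990] J. D. Rogawski, *Automorphic Representations of Unitary Groups in Three Variables*, Ann. of Math. Stud. 123 (1990): §4.9 Prop. 4.9.1 (b) p. 55, Lemma 4.9.3 p. 56;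
  §4.3 (4.3.1) p. 43.
-/

set_option autoImplicit false

noncomputable section

open scoped Matrix MatrixGroups Classical ValuativeRel WithZero Topology
open MeasureTheory Measure NumberField IsDedekindDomain Matrix Filter
open Literature.NumberTheory.Automorphic Literature.NumberTheory.Automorphic.UnitaryGroup Literature.NumberTheory.Automorphic.HermitianLattice
open Literature.NumberTheory.Automorphic.UnitaryLatticeTree Literature.NumberTheory.Rogawski1990 Literature.NumberTheory.GaloisRepresentations
open Literature.NumberTheory.Automorphic.UnitaryThreeFourFrame
open Summit.HodgeConjecture.HodgeConjecture.Cruxes.H413.F0P3cDyRamFourFrameHFamilyDefs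
open Summit.HodgeConjecture.HodgeConjecture.Cruxes.H413.F0P3cDyRamFourFrameLawDefsR (shiftR)
open Summit.HodgeConjecture.HodgeConjecture.Cruxes.H413.F0P3cDyRamRowOneAtCoefStar

namespace Summit.HodgeConjecture.HodgeConjecture.Cruxes.H413.F0P3cDyRamRowTwoAtCoefStar

/-! ## §1 The algebra of ROW (2) at coef* -/

/-- **ROW (2) algebra**: if `Φ_s = ν_s·X + lam_s∕2` for both `s`, `Σ_s coef_s ν_s = C`-via-`κ` (`Σ coef_s (2ν_s) = 2C`), `Σ_s coef_s lam_s = −(C·T)` and the G-side equals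
`C·X − C·T∕2`, then `G = Σ_s coef_s Φ_s`. [cite: Rogawski1990, §4.3 (4.3.1) p. 43] -/
theorem rowTwo_algebra {G C T X ν₀ ν₁ c₀ c₁ l₀ l₁ Φ₀ Φ₁ : ℂ}
    (hΦ₀ : Φ₀ = ν₀ * X + l₀ / 2) (hΦ₁ : Φ₁ = ν₁ * X + l₁ / 2)
    (hκ : c₀ * (2 * ν₀) + c₁ * (2 * ν₁) = 2 * C) (hlam : c₀ * l₀ + c₁ * l₁ = -(C * T))
    (hG : G = C * X - C * T / 2) : G = c₀ * Φ₀ + c₁ * Φ₁ := by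
  rw [hG, hΦ₀, hΦ₁]
  linear_combination (X / 2) * hκ.symm + (1 / 2 : ℂ) * hlam.symm

/-! ## §2 HEAD: ROW (2) of (ρ) at coef*, from (ρ2a) and (ρ2b) -/

/-- **ROW (2) OF (ρ) AT THE EXPLICIT COEFFICIENTS, FROM ITS TWO CHILDREN** — the payer of `stub_U2H_rowTwo_unit0` once (ρ2a) `stub_U2H_hProfiles_typeTwo_affine_wild` (the TYPE-(2)
H-dictionary in affine form: `∃ X, ∀ s, Φ^st(γ_H, hFamily s) = ν_s·X + lam*_s∕2` on the type-(2) population near 1) and (ρ2b) `stub_U2H_gSide_typeTwo_unit0` (the κ-gated G-side: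
`Σᶠ_c Δ‴·Φ(c, 1_{K_t}) = C·Φ^st(γ_H, h_{s_V})∕ν_{s_V} − 2C(q^S − 1)∕(q − 1)`, `s_V = d % 2`) land: the (ρ) telescope through `(C : ℂ)` VERBATIM, `h2a`, `h2b` ⇒ ROW (2) conjunct of
`stub_U2H_rowsR_hFamily_unit0` with `coef s ↦ coef* s` TOKEN FOR TOKEN.  Scalars: ★ `sum_coefStar_mul_kappaStar`, ★ `sum_coefStar_mul_lamStar`, `ν_s ≠ 0` ★
`measureReal_support_hFamily_ne_zero`, `q ≥ 2`. [cite: Rogawski1990, §4.9 Prop. 4.9.1 (b) p. 55, Lemma 4.9.3 p. 56; §4.3 (4.3.1) p. 43] -/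
theorem rowTwo_coefStar_of_hProfiles_affine_of_gSide :
    ∀ (L : Type) [Field L] [NumberField L] [IsCMField L]
      {v : HeightOneSpectrum (𝓞 ↥(maximalRealSubfield L))} (w : UnitaryGroup.PlacesOver L v)
      (hw : IsCMField.complexConj L • w.1 = w.1) (_he : v.asIdeal.ramificationIdx' w.1.asIdeal ≠ 1)
      (_h2 : ¬ IsUnit (2 : 𝒪[w.1.adicCompletion L]))
      (ϖ : (w.1.adicCompletion L)) (_hϖ : Valued.v ϖ = WithZero.exp (-1 : ℤ)) (d tE : ℕ) (_hD : IsRamifiedQuadraticDatum (galAdicCompletionMap (L := L) (IsCMField.complexConj L) hw) ϖ d tE)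
      [Fintype (Valued.ResidueField (w.1.adicCompletion L))] (δ : (w.1.adicCompletion L)) (_hδ : (galAdicCompletionMap (L := L) (IsCMField.complexConj L) hw) δ = -δ) (_hδ0 : δ ≠ 0)
      (μ : HeckeCharacter L) (_hμu : μ.IsUnitary)
      (_hμω : ∀ x : ideleGroup ↥(maximalRealSubfield L), μ (AdeleRing.ideleBaseChange ↥(maximalRealSubfield L) L x) = quadraticHeckeCharCM L x)
      [MeasurableSpace ((UnitaryGroup.cmDatum L 3 (Matrix.of fun i j : Fin 3 => if i.val + j.val + 1 = 3 then (1 : L) else 0)).Local v)] [BorelSpace ((UnitaryGroup.cmDatum L 3 (Matrix.of fun i j : Fin 3 => if i.val + j.val + 1 = 3 then (1 : L) else 0)).Local v)]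
      [∀ γ : ((UnitaryGroup.cmDatum L 3 (Matrix.of fun i j : Fin 3 => if i.val + j.val + 1 = 3 then (1 : L) else 0)).Local v), MeasurableSpace (((UnitaryGroup.cmDatum L 3 (Matrix.of fun i j : Fin 3 => if i.val + j.val + 1 = 3 then (1 : L) else 0)).Local v) ⧸ Subgroup.centralizer ({γ} : Set ((UnitaryGroup.cmDatum L 3 (Matrix.of fun i j : Fin 3 => if i.val + j.val + 1 = 3 then (1 : L) else 0)).Local v)))]
      [∀ γ : ((UnitaryGroup.cmDatum L 3 (Matrix.of fun i j : Fin 3 => if i.val + j.val + 1 = 3 then (1 : L) else 0)).Local v), BorelSpace (((UnitaryGroup.cmDatum L 3 (Matrix.of fun i j : Fin 3 => if i.val + j.val + 1 = 3 then (1 : L) else 0)).Local v) ⧸ Subgroup.centralizer ({γ} : Set ((UnitaryGroup.cmDatum L 3 (Matrix.of fun i j : Fin 3 => if i.val + j.val + 1 = 3 then (1 : L) else 0)).Local v)))]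
      [MeasurableSpace ((UnitaryGroup.cmDatum L 2 (Matrix.of fun i j : Fin 2 => if i.val + j.val + 1 = 2 then (1 : L) else 0)).Local v × (UnitaryGroup.cmDatum L 1 (Matrix.of fun i j : Fin 1 => if i.val + j.val + 1 = 1 then (1 : L) else 0)).Local v)] [BorelSpace ((UnitaryGroup.cmDatum L 2 (Matrix.of fun i j : Fin 2 => if i.val + j.val + 1 = 2 then (1 : L) else 0)).Local v × (UnitaryGroup.cmDatum L 1 (Matrix.of fun i j : Fin 1 => if i.val + j.val + 1 = 1 then (1 : L) else 0)).Local v)]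
      [∀ a : ((UnitaryGroup.cmDatum L 2 (Matrix.of fun i j : Fin 2 => if i.val + j.val + 1 = 2 then (1 : L) else 0)).Local v × (UnitaryGroup.cmDatum L 1 (Matrix.of fun i j : Fin 1 => if i.val + j.val + 1 = 1 then (1 : L) else 0)).Local v), MeasurableSpace (((UnitaryGroup.cmDatum L 2 (Matrix.of fun i j : Fin 2 => if i.val + j.val + 1 = 2 then (1 : L) else 0)).Local v × (UnitaryGroup.cmDatum L 1 (Matrix.of fun i j : Fin 1 => if i.val + j.val + 1 = 1 then (1 : L) else 0)).Local v) ⧸ Subgroup.centralizer ({a} : Set ((UnitaryGroup.cmDatum L 2 (Matrix.of fun i j : Fin 2 => if i.val + j.val + 1 = 2 then (1 : L) else 0)).Local v × (UnitaryGroup.cmDatum L 1 (Matrix.of fun i j : Fin 1 => if i.val + j.val + 1 = 1 then (1 : L) else 0)).Local v)))]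
      [∀ a : ((UnitaryGroup.cmDatum L 2 (Matrix.of fun i j : Fin 2 => if i.val + j.val + 1 = 2 then (1 : L) else 0)).Local v × (UnitaryGroup.cmDatum L 1 (Matrix.of fun i j : Fin 1 => if i.val + j.val + 1 = 1 then (1 : L) else 0)).Local v), BorelSpace (((UnitaryGroup.cmDatum L 2 (Matrix.of fun i j : Fin 2 => if i.val + j.val + 1 = 2 then (1 : L) else 0)).Local v × (UnitaryGroup.cmDatum L 1 (Matrix.of fun i j : Fin 1 => if i.val + j.val + 1 = 1 then (1 : L) else 0)).Local v) ⧸ Subgroup.centralizer ({a} : Set ((UnitaryGroup.cmDatum L 2 (Matrix.of fun i j : Fin 2 => if i.val + j.val + 1 = 2 then (1 : L) else 0)).Local v × (UnitaryGroup.cmDatum L 1 (Matrix.of fun i j : Fin 1 => if i.val + j.val + 1 = 1 then (1 : L) else 0)).Local v)))]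
      (νH : Measure ((UnitaryGroup.cmDatum L 2 (Matrix.of fun i j : Fin 2 => if i.val + j.val + 1 = 2 then (1 : L) else 0)).Local v × (UnitaryGroup.cmDatum L 1 (Matrix.of fun i j : Fin 1 => if i.val + j.val + 1 = 1 then (1 : L) else 0)).Local v)) [νH.IsHaarMeasure] [νH.IsMulRightInvariant]
      (νG₃ : Measure ((UnitaryGroup.cmDatum L 3 (Matrix.of fun i j : Fin 3 => if i.val + j.val + 1 = 3 then (1 : L) else 0)).Local v)) [νG₃.IsHaarMeasure] [νG₃.IsMulRightInvariant]
      (mH : OrbitalMeasureFamily ((UnitaryGroup.cmDatum L 2 (Matrix.of fun i j : Fin 2 => if i.val + j.val + 1 = 2 then (1 : L) else 0)).Local v × (UnitaryGroup.cmDatum L 1 (Matrix.of fun i j : Fin 1 => if i.val + j.val + 1 = 1 then (1 : L) else 0)).Local v)) (mG₃ : OrbitalMeasureFamily ((UnitaryGroup.cmDatum L 3 (Matrix.of fun i j : Fin 3 => if i.val + j.val + 1 = 3 then (1 : L) else 0)).Local v))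
      (_hmH : mH.IsCanonical (IsLocalGRegular L v) νH) (_hmG : mG₃.IsCanonical (fun γ => IsRegularElt (γ.val : GL (Fin 3) (UnitaryGroup.LocalRing L v))) νG₃)
      (N : Submodule (Valued.integer (w.1.adicCompletion L)) (Fin 3 → (w.1.adicCompletion L))) (_hN : IsVertexLattice (galAdicCompletionMap (L := L) (IsCMField.complexConj L) hw) ϖ ((StdForm.antidiagonal 3).over (w.1.adicCompletion L)) 0 N)
      (Kt : Subgroup ((UnitaryGroup.cmDatum L 3 (Matrix.of fun i j : Fin 3 => if i.val + j.val + 1 = 3 then (1 : L) else 0)).Local v)) (_hKt : ∀ u : ((UnitaryGroup.cmDatum L 3 (Matrix.of fun i j : Fin 3 => if i.val + j.val + 1 = 3 then (1 : L) else 0)).Local v), u ∈ Kt ↔ mapGL ((localNonsplitEquiv (IsCMField.complexConj L) (Matrix.of fun i j : Fin 3 => if i.val + j.val + 1 = 3 then (1 : L) else 0) (IsCMField.complexConj_ne_one L) w hw u :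
              ↥(unitaryGroupOfForm (galAdicCompletionMap (L := L) (IsCMField.complexConj L) hw) (placeForm (Matrix.of fun i j : Fin 3 => if i.val + j.val + 1 = 3 then (1 : L) else 0) w.1))) : GL (Fin 3) (w.1.adicCompletion L)) N = N)
      (C : ℂ)
      (_h2a : ∃ V ∈ 𝓝 (1 : ((UnitaryGroup.cmDatum L 2 (Matrix.of fun i j : Fin 2 => if i.val + j.val + 1 = 2 then (1 : L) else 0)).Local v × (UnitaryGroup.cmDatum L 1 (Matrix.of fun i j : Fin 1 => if i.val + j.val + 1 = 1 then (1 : L) else 0)).Local v)), ∀ γH ∈ V, IsLocalGRegular L v γH →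
              ¬ (∃ x : (w.1.adicCompletion L), (((((γH).1.val : GL (Fin 2) (UnitaryGroup.LocalRing L v)).val.map (Pi.evalRingHom (fun w' : UnitaryGroup.PlacesOver L v => w'.1.adicCompletion L) w))).charpoly).IsRoot x) →
              ∃ X : ℂ, ∀ s : Fin 2, stableOrbitalIntegralRel (IsLocalStablyConjH L v) mH (hFamily L w hw ϖ s) γH = (νH.real (Function.support (hFamily L w hw ϖ s)) : ℂ) * X + (if ((s : Fin 2) : ℕ) = d % 2 then (0 : ℂ) else -2 * (νH.real (Function.support (hFamily L w hw ϖ s)) : ℂ)) / 2)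
      (_h2b : ∃ V ∈ 𝓝 (1 : ((UnitaryGroup.cmDatum L 2 (Matrix.of fun i j : Fin 2 => if i.val + j.val + 1 = 2 then (1 : L) else 0)).Local v × (UnitaryGroup.cmDatum L 1 (Matrix.of fun i j : Fin 1 => if i.val + j.val + 1 = 1 then (1 : L) else 0)).Local v)), ∀ γH ∈ V, IsLocalGRegular L v γH →
              ¬ (∃ x : (w.1.adicCompletion L), (((((γH).1.val : GL (Fin 2) (UnitaryGroup.LocalRing L v)).val.map (Pi.evalRingHom (fun w' : UnitaryGroup.PlacesOver L v => w'.1.adicCompletion L) w))).charpoly).IsRoot x) →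
              ∑ᶠ c : ConjClasses ((UnitaryGroup.cmDatum L 3 (Matrix.of fun i j : Fin 3 => if i.val + j.val + 1 = 3 then (1 : L) else 0)).Local v), ((finExplicitCollection L (Matrix.of fun i j : Fin 3 => if i.val + j.val + 1 = 3 then (1 : L) else 0) μ (finExplicitDelta_conj_left_all L (Matrix.of fun i j : Fin 3 => if i.val + j.val + 1 = 3 then (1 : L) else 0) μ) (finExplicitDelta_conj_right_all L (Matrix.of fun i j : Fin 3 => if i.val + j.val + 1 = 3 then (1 : L) else 0) μ)) v).Δ γH (Quotient.out c) * classOrbitalIntegral mG₃ (Set.indicator (Kt : Set ((UnitaryGroup.cmDatum L 3 (Matrix.of fun i j : Fin 3 => if i.val + j.val + 1 = 3 then (1 : L) else 0)).Local v)) (fun _ => (1 : ℂ))) c =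
                C * (if d % 2 = 1 then stableOrbitalIntegralRel (IsLocalStablyConjH L v) mH (hFamily L w hw ϖ 1) γH / (νH.real (Function.support (hFamily L w hw ϖ 1)) : ℂ) else stableOrbitalIntegralRel (IsLocalStablyConjH L v) mH (hFamily L w hw ϖ 0) γH / (νH.real (Function.support (hFamily L w hw ϖ 0)) : ℂ)) - 2 * C * (((Fintype.card (Valued.ResidueField (w.1.adicCompletion L)) : ℕ) : ℂ) ^ (shiftR d tE) - 1) / (((Fintype.card (Valued.ResidueField (w.1.adicCompletion L)) : ℕ) : ℂ) - 1)),
        ∃ V ∈ 𝓝 (1 : ((UnitaryGroup.cmDatum L 2 (Matrix.of fun i j : Fin 2 => if i.val + j.val + 1 = 2 then (1 : L) else 0)).Local v × (UnitaryGroup.cmDatum L 1 (Matrix.of fun i j : Fin 1 => if i.val + j.val + 1 = 1 then (1 : L) else 0)).Local v)), ∀ γH ∈ V, IsLocalGRegular L v γH →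
        ¬ (∃ x : (w.1.adicCompletion L), (((((γH).1.val : GL (Fin 2) (UnitaryGroup.LocalRing L v)).val.map (Pi.evalRingHom (fun w' : UnitaryGroup.PlacesOver L v => w'.1.adicCompletion L) w))).charpoly).IsRoot x) →
        ∑ᶠ c : ConjClasses ((UnitaryGroup.cmDatum L 3 (Matrix.of fun i j : Fin 3 => if i.val + j.val + 1 = 3 then (1 : L) else 0)).Local v), ((finExplicitCollection L (Matrix.of fun i j : Fin 3 => if i.val + j.val + 1 = 3 then (1 : L) else 0) μ (finExplicitDelta_conj_left_all L (Matrix.of fun i j : Fin 3 => if i.val + j.val + 1 = 3 then (1 : L) else 0) μ) (finExplicitDelta_conj_right_all L (Matrix.of fun i j : Fin 3 => if i.val + j.val + 1 = 3 then (1 : L) else 0) μ)) v).Δ γH (Quotient.out c) * classOrbitalIntegral mG₃ (Set.indicator (Kt : Set ((UnitaryGroup.cmDatum L 3 (Matrix.of fun i j : Fin 3 => if i.val + j.val + 1 = 3 then (1 : L) else 0)).Local v)) (fun _ => (1 : ℂ))) c =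
          ∑ s, ((if ((s : Fin 2) : ℕ) = d % 2 then C * ((((Fintype.card (Valued.ResidueField (w.1.adicCompletion L)) : ℕ) : ℂ) + 1) - 2 * ((Fintype.card (Valued.ResidueField (w.1.adicCompletion L)) : ℕ) : ℂ) ^ (shiftR d tE)) else 2 * C * (((Fintype.card (Valued.ResidueField (w.1.adicCompletion L)) : ℕ) : ℂ) ^ (shiftR d tE) - 1)) / ((((Fintype.card (Valued.ResidueField (w.1.adicCompletion L)) : ℕ) : ℂ) - 1) * (νH.real (Function.support (hFamily L w hw ϖ s)) : ℂ))) * stableOrbitalIntegralRel (IsLocalStablyConjH L v) mH (hFamily L w hw ϖ s) γH := by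
  intro L _ _ _ v w hw he h2 ϖ hϖ d tE hD _ δ hδ hδ0 μ hμu hμω _ _ _ _ _ _ _ _ νH _ _ νG₃ _ _ mH mG₃ hmH hmG N hN Kt hKt C h2a h2b
  have hν0 := F0P3cDyRamRowThreeReduction.measureReal_support_hFamily_ne_zero L w hw he ϖ hϖ νH 0
  have hν1 := F0P3cDyRamRowThreeReduction.measureReal_support_hFamily_ne_zero L w hw he ϖ hϖ νH 1
  have hq := natCast_card_residueField_sub_one_ne_zero L w
  obtain ⟨V₁, hV₁, h₁⟩ := h2a
  obtain ⟨V₂, hV₂, h₂⟩ := h2b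
  refine ⟨V₁ ∩ V₂, inter_mem hV₁ hV₂, fun γH hγ hreg htwo => ?_⟩
  obtain ⟨X, hX⟩ := h₁ γH hγ.1 hreg htwo
  have hG := h₂ γH hγ.2 hreg htwo
  have hX0 := hX 0
  have hX1 := hX 1
  -- the vertex profile pins `X`: `Φ^st(h_{s_V}) ∕ ν_{s_V} = X` (its offset `lam*_{s_V}` is `0`)
  have hXV : (if d % 2 = 1 then stableOrbitalIntegralRel (IsLocalStablyConjH L v) mH (hFamily L w hw ϖ 1) γH / (νH.real (Function.support (hFamily L w hw ϖ 1)) : ℂ)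
      else stableOrbitalIntegralRel (IsLocalStablyConjH L v) mH (hFamily L w hw ϖ 0) γH / (νH.real (Function.support (hFamily L w hw ϖ 0)) : ℂ)) = X := by
    rcases Nat.mod_two_eq_zero_or_one d with hd | hd
    · rw [if_neg (by omega), hX0]
      simp only [Fin.val_zero, hd, if_true, zero_div, add_zero]
      field_simp
    · rw [if_pos hd, hX1]
      simp only [Fin.val_one, hd, if_true, zero_div, add_zero]
      field_simp
  rw [hXV] at hG
  rw [Fin.sum_univ_two]
  refine rowTwo_algebra (T := 4 * (((Fintype.card (Valued.ResidueField (w.1.adicCompletion L)) : ℕ) : ℂ) ^ (shiftR d tE) - 1) / (((Fintype.card (Valued.ResidueField (w.1.adicCompletion L)) : ℕ) : ℂ) - 1)) hX0 hX1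
    (sum_coefStar_mul_kappaStar (C := C) hq hν0 hν1 d (shiftR d tE)) (sum_coefStar_mul_lamStar (C := C) hq hν0 hν1 d (shiftR d tE)) ?_
  rw [hG]
  ring

end Summit.HodgeConjecture.HodgeConjecture.Cruxes.H413.F0P3cDyRamRowTwoAtCoefStar

end
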